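import Literature.Analysis.OperatorTheory.PositiveKernelTransferOperator
import HarnessLib

/-!
# Stub `stub_kernelOpTranspose` (R5) of line `Sketch`, crux `PencilRigidity.WeakCouplingHypercubicLimit`

ABSTRACT `L²` operator theory (no gauge theory): the integral operator of the TRANSPOSED kernel is the
adjoint. For bounded strongly measurable real kernels `X_a`, `X_b` on a probability space `(X, μ)` with
`X_b(x, y) = X_a(y, x)`, and bounded operators `Â`, `B̂` on `Lp ℝ 2 μ` acting a.e. as the kernel
integrals `φ ↦ ∫ X_a(·, y) φ(y) dμ(y)`, `φ ↦ ∫ X_b(·, y) φ(y) dμ(y)` (as delivered by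
`Literature.Analysis.OperatorTheory.exists_kernelOp`), one has `⟪f, Â g⟫ = ⟪B̂ f, g⟫` for all
`f, g ∈ L²(μ)`. This is the non-symmetric twin of the toolkit's `isSelfAdjoint_kernelOp`
(`PositiveKernelTransferOperator.lean`), proved by the same Fubini computation:
`⟪f, Â g⟫ = ∫ f(x) ∫ X_a(x,y) g(y) = ∫∫ f(x) X_a(x,y) g(y)` (`inner_kernelOp_eq_integral`,
`integral_const_mul`), swap the two integrals (`integral_integral_swap`, integrability of
`f(x) X_a(x,y) g(y)` on `μ ⊗ μ` from `integrable_mul_kernel_mul`: `L² ⊆ L¹` on a finite measure space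
and `|X_a| ≤ C`), and read the result as `∫ g(y) ∫ X_b(y,x) f(x) = ⟪g, B̂ f⟫ = ⟪B̂ f, g⟫`.

References: M. Reed, B. Simon, *Methods of Modern Mathematical Physics I* (1980), §VI.6
(Hilbert–Schmidt integral operators; the adjoint kernel is `K*(x,y) = conj K(y,x)`). [folklore]
-/

noncomputable section

open scoped RealInnerProductSpace ENNReal
open MeasureTheory Filter

namespace Summit.QuantumFields.YangMills.Theorems.WeakCouplingHypercubicLimit.TraceNormColdPressure

open Literature.Analysis.OperatorTheory

/-- `stub_kernelOpTranspose` (R5, r8; ABSTRACT `L²` operator theory) — **the integral operator of the transposed kernel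
is the adjoint**: for bounded strongly measurable kernels `X_a`, `X_b` on a probability space with `X_b(x,y) = X_a(y,x)`
and `L²` operators `Â`, `B̂` acting a.e. as the kernel integrals (`exists_kernelOp`), `⟪f, Â g⟫ = ⟪B̂ f, g⟫` on
`L²(μ)` (Fubini; the non-symmetric twin of `isSelfAdjoint_kernelOp`). [folklore] -/
theorem stub_kernelOpTranspose :
    ∀ (X : Type) [MeasurableSpace X] (μ : Measure X) [IsProbabilityMeasure μ] (Xa Xb : X → X → ℝ) (C : ℝ),
      StronglyMeasurable (Function.uncurry Xa) → StronglyMeasurable (Function.uncurry Xb) →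
      (∀ x y, ‖Xa x y‖ ≤ C) → (∀ x y, ‖Xb x y‖ ≤ C) → (∀ x y, Xb x y = Xa y x) →
    ∀ (Aop Bop : Lp ℝ 2 μ →L[ℝ] Lp ℝ 2 μ),
      (∀ φ : Lp ℝ 2 μ, (Aop φ : X → ℝ) =ᵐ[μ] fun x => ∫ y, Xa x y * φ y ∂μ) →
      (∀ φ : Lp ℝ 2 μ, (Bop φ : X → ℝ) =ᵐ[μ] fun x => ∫ y, Xb x y * φ y ∂μ) →
    ∀ f g : Lp ℝ 2 μ, inner ℝ f (Aop g) = inner ℝ (Bop f) g := by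
  intro X _ μ _ Xa Xb C hXa _ hCa _ hT Aop Bop hA hB f g
  -- `⟪B̂ f, g⟫ = ⟪g, B̂ f⟫`, then both sides as iterated integrals
  rw [real_inner_comm g (Bop f), inner_kernelOp_eq_integral hA, inner_kernelOp_eq_integral hB]
  -- `∫ f x ∫ Xa x y g y = ∫ g y ∫ Xb y x f x`
  have h1 : ∫ x, f x * ∫ y, Xa x y * g y ∂μ ∂μ = ∫ x, ∫ y, f x * (Xa x y * g y) ∂μ ∂μ := by
    refine integral_congr_ae (Eventually.of_forall fun x => ?_)
    exact (integral_const_mul (f x) _).symm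
  have h2 : ∫ x, g x * ∫ y, Xb x y * f y ∂μ ∂μ = ∫ x, ∫ y, g x * (Xb x y * f y) ∂μ ∂μ := by
    refine integral_congr_ae (Eventually.of_forall fun x => ?_)
    exact (integral_const_mul (g x) _).symm
  rw [h1, h2, integral_integral_swap (integrable_mul_kernel_mul hXa hCa f g)]
  refine integral_congr_ae (Eventually.of_forall fun y => ?_)
  refine integral_congr_ae (Eventually.of_forall fun x => ?_)
  dsimp only
  rw [hT y x]
  ring

end Summit.QuantumFields.YangMills.Theorems.WeakCouplingHypercubicLimit.TraceNormColdPressure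

end
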